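import Summits.BirchSwinnertonDyer.BirchSwinnertonDyer.Theorems.EisensteinPrimesBSDpOnCellCTelescopeK2ModuleDivOfLeaves
import Summits.BirchSwinnertonDyer.BirchSwinnertonDyer.Theorems.EisensteinPrimesBSDpOnCellCTelescopeK2FibreCofinite
import Summits.BirchSwinnertonDyer.BirchSwinnertonDyer.Theorems.EisensteinPrimesBSDpOnCellCTelescopeK2TorsionSelmerCofinite
import Summits.BirchSwinnertonDyer.BirchSwinnertonDyer.Theorems.EisensteinPrimesBSDpOnCellCTelescopeK2WeightTwoTransportOfInputs
import HarnessLib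

/-!
# Crux 4 `BSDpOnCellC` (stmt-BirchSwinnertonDyer-19034), line «telescope» v9, leaf N2 `stub_weightTwoControl`, sub-leaf W3:
# the LEAD's input (W3-fg) — `Module.Finite ℤ_p⟦T⟧ (Sel_{𝔭̄,∅}(K, M₂[C X])^∨)` — PROVED in the LEAD's text, by name
# (ideator helper #11; `--supports`, helper; THEOREMS ONLY; closes nothing)

Route `EisensteinPrimes`, crux `BSDpOnCellC`; ideator seat `bsd-idea-12` (gen 37). HONEST FRAMING: no registered stub, no crux, no
summit statement is proved here; BSD is proved for no curve. This file discharges ONE of the TWO inputs of the successor LEAD's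
(cruxlead-19034 g3) `TelescopeK2WeightTwoTransportOfInputs.weightTwoTransport_of_inputs : (I-E) → (W3-fg) → W3`, namely (W3-fg): its
statement below is the LEAD's `hfg` binder (HOME-cell file `EisensteinPrimesBSDpOnCellCTelescopeK2WeightTwoTransportOfInputs.lean`,
sha16 791c1c24de2916b5, l.97–175) TOKEN FOR TOKEN — the road-R-β / telescope-N2 prefix, N1's fibre data `hFD`, then for every compatible
`Λ = ℤ_p⟦T⟧`-structure on `Y = CharacterModule (Sel_{strict 𝔭̄, Σ = ∅}(K, (A₂ ⊗ B^*)[C X]))` (`B = ℤ_p⟦X⟧⟦T⟧`): `Module.Finite Λ Y`.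

PROOF (every step a tree theorem, by name): from `hFD` keep (tor) `∀ a, ∃ n, X^n • a = 0`, (unr) `∃ S₀ finite, ρ₂ unramified outside S₀`
and (fd₀) `θ₀ : A₂[X] → E[p^∞]` (`C`-linear, finite kernel); then
`TelescopeK2FibreCofinite.isCofinitelyGenerated_bigRepModule_twoVar_of_fd_primaryTorsion` (ideator helper #9) gives the cofinite generation
`hD` of `A₂ ⊗ B^*` over `B`; `TelescopeK2TorsionSelmerCofinite.module_finite_characterModule_selmer_torsionRep_twoVar_of_isUnramifiedOutside`
(helper #10 §3; Greenberg 2006 Prop. 3.2 for the cofinitely generated discrete module `M₂[C X]`, via p748332/p748872) gives `Module.Finite B Y`;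
`C X` kills `Y` (`smul_characterModule_selmer_torsionRep_eq_zero`, #10 §5) and `B = Λ·1 + (C X)·B` under `PowerSeries.algebraPowerSeries`
(`module_finite_powerSeries_of_twoVar`, #10 §4) gives `Module.Finite Λ Y` for the binder's `[Module Λ Y] [IsScalarTower Λ B Y]`.
After this file and the LEAD's two files, sub-leaf W3 rests on the single E-side input (I-E).
ALSO `bigModuleFinite : <W1 text>` — sub-leaf W1 `K2Weight2.stub_bigModuleFinite` of the ideator workfile
`Cruxes/BSDpOnCellC/Lines/telescopeK2weight2.lean` (tree sha16 f79169b78eb6710b, l.129–201, extracted programmatically) = conjunct (fg)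
`Module.Finite B (XBig κ ρ₂ 𝔭̄ ∅)` under the same prefix, PROVED by name: `hD` as above, then
`TelescopeK2BigRepUnramified.module_finite_XBig_twoVar_of_isUnramifiedOutside` (p748872 → p748332, Greenberg 2006 Prop. 3.2).
COROLLARY `weightTwoTransport_of_E : (I-E) → W3` := `weightTwoTransport_of_inputs hE weightTwoFg` — the LEAD's theorem (p751200) with
its second input discharged; hypothesis = the LEAD's `hE` binder (l.73–94) and conclusion = W3's text (l.177–262), both extracted
programmatically from the landed file (token for token).

References: [Greenberg2006] Prop. 3.2 (p. 358 L37); [GreenbergLNM1716] §4; [SkinnerUrban2014] §3.1.3, Prop. 3.2.3; [Castella2018Erratum] §2.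

## References
[cite: Greenberg2006, §3 A Prop. 3.2 (p. 358 L37)] [cite: GreenbergLNM1716, §4] [cite: SkinnerUrban2014, §3.1.3] [cite: Castella2018Erratum, §2, Lemma 2.1 (p. 2)]
-/

set_option autoImplicit false
set_option linter.dupNamespace false

noncomputable section

open scoped Classical MatrixGroups ModularForm

open CongruenceSubgroup WeierstrassCurve NumberField IsDedekindDomain Field PowerSeries
  Literature.NumberTheory.EllipticCurves Literature.NumberTheory.EllipticCurves.GreenbergSelmer
  Literature.NumberTheory.EllipticCurves.ModularForms Literature.NumberTheory.QuadraticFields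
  Literature.NumberTheory.EllipticCurves.Rank1Residual
  Literature.NumberTheory.EllipticCurves.Rank1Residual.Typed
  Literature.NumberTheory.GaloisRepresentations Literature.NumberTheory.GaloisCohomology
  Summit.BirchSwinnertonDyer.Rank1Residual.X11b.AcSelmer
  Summit.BirchSwinnertonDyer.Rank1Residual.X11b.Halves
  Summit.BirchSwinnertonDyer.Rank1Residual.X11b
  Summit.BirchSwinnertonDyer.Rank1Residual Summit.BirchSwinnertonDyer.Rank1Residual.X1
  Summit.BirchSwinnertonDyer.Rank1Residual.X2

open Literature.NumberTheory.EllipticCurves.BigGaloisRep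
open Literature.NumberTheory.EllipticCurves.Castella2018

namespace Summit.BirchSwinnertonDyer.BirchSwinnertonDyer.Theorems.TelescopeK2WeightTwoFg

open Summit.BirchSwinnertonDyer.BirchSwinnertonDyer.Theorems

set_option maxHeartbeats 1600000 in
/-- **(W3-fg): the weight-two fibre's strict Selmer dual is a finitely generated `ℤ_p⟦T⟧`-module** — the LEAD's `hfg` input of
`TelescopeK2WeightTwoTransportOfInputs.weightTwoTransport_of_inputs`, token for token, proved by name from N1's fibre data
((tor), (unr), (fd₀)) through helpers #9/#10 and Greenberg 2006 Prop. 3.2.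
[cite: Greenberg2006, §3 A Prop. 3.2 (p. 358 L37)] [cite: Castella2018Erratum, §2, Lemma 2.1 (p. 2)] -/
theorem weightTwoFg :
    ∀ (W : WeierstrassCurve ℚ) [W.IsElliptic] [W.IsGloballyMinimal] (p : ℕ) [Fact p.Prime],
    ∀ (N : ℕ) [NeZero N] (K : Type) [Field K] [NumberField K] (Dt : ModularParametrizationData W N)
      (H : HeegnerDatum N (NumberField.discr K)) (ιK : K →+* ℂ) (P : (W.baseChange K).toAffine.Point),
      CellC W p → W.conductorNorm ℤ = N →
      IsImaginaryQuadratic K → NumberField.discr K < -4 → SatisfiesHeegnerHypothesis N K →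
      (W.quadraticTwist (NumberField.discr K : ℚ)).entireLFunction 1 ≠ 0 →
      WeierstrassCurve.Affine.Point.map ιK.toRatAlgHom P = heegnerPointComplex Dt H →
      ¬ (p : ℤ) ∣ Dt.c → ¬ IsOfFinAddOrder P →
      Odd (NumberField.discr K) →
      ∀ (κ : ZpExtension K p), κ.IsAnticyclotomic →
        ∀ (γ : Field.absoluteGaloisGroup K) [Fact (κ.IsTopGenerator γ)]
          (𝔭 : HeightOneSpectrum (𝓞 K)), ((p : ℕ) : 𝓞 K) ∈ 𝔭.asIdeal →
          𝔭.asIdeal.ramificationIdx (𝓞 ℚ) = 1 → 𝔭.asIdeal.inertiaDeg (𝓞 ℚ) = 1 →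
          ∀ (𝔭bar : HeightOneSpectrum (𝓞 K)), ((p : ℕ) : 𝓞 K) ∈ 𝔭bar.asIdeal → 𝔭bar ≠ 𝔭 →
            ((Ideal.span {(p : ℤ)}).primesOver (𝓞 K)).ncard = 2 →
          ∀ (f : CuspForm (CongruenceSubgroup.Gamma0 N) 2), IsNewformOf W f →
            ∀ (ι' : PadicAlgCl p ≃+* ℂ),
              (∀ (w : InfinitePlace K) (k : 𝓞 K),
                k ∈ 𝔭.asIdeal ↔ ‖ι'.symm (w.embedding (k : K))‖ < 1) →
              ∀ (ΩK : ℂ) (Ωp : ℂ_[p]) (Q : PowerSeries 𝓞_ℂ_[p]), ΩK ≠ 0 → ‖Ωp‖ = 1 →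
                R1.IsBDPLFunctionInt p ι' 𝔭 κ γ f ΩK Ωp Q →
      ∀ (L : PowerSeries (PowerSeries (unrIntegers p))) (x : ℕ → ℤ_[p]) (D : ℕ → Skinner2016.HidaCongruentForm W p 1),
        (∀ k, ‖x k‖ < 1) ∧ Filter.Tendsto x Filter.atTop (nhds 0) ∧
        (∃ e : ℕ, PowerSeries.C ((p : 𝓞_ℂ_[p]) ^ e) * Q ∈
          Ideal.span {PowerSeries.map (R1.unrToCpInt p) (PowerSeries.map (PowerSeries.constantCoeff (R := unrIntegers p)) L)}) ∧
        (∀ k : ℕ, (∀ y : coeffField (D k).g, ι' ((D k).ι y) = (y : ℂ)) ∧ 2 * ((p : ℤ) - 1) ∣ (D k).k - 2 ∧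
          ∃ (ΩKg : ℂ) (Ωpg : ℂ_[p]) (Lg : UnrSeries p), ΩKg ≠ 0 ∧ ‖Ωpg‖ = 1 ∧
            IsBDPLFunctionWt ι' 𝔭 κ γ (D k).g ΩKg Ωpg Lg ∧
          ∃ Ψ : UnrSeries p,
            (∃ U : PowerSeries (PowerSeries (unrIntegers p)),
              PowerSeries.map (PowerSeries.C (R := unrIntegers p)) Ψ =
                L + PowerSeries.C (PowerSeries.X - PowerSeries.C (toUnr p (x k))) * U) ∧
            (∃ e : ℕ, PowerSeries.C ((p : 𝓞_ℂ_[p]) ^ e) * PowerSeries.map (R1.unrToCpInt p) Ψ ∈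
              Ideal.span {PowerSeries.map (R1.unrToCpInt p) Lg})) ∧
        (∃ A : ℕ → UnrSeries p, ∀ ℓ : ℕ, ℓ.Prime → ¬ ℓ ∣ N →
          (∃ U : UnrSeries p, A ℓ = PowerSeries.C (toUnr p ((W.frobeniusTrace ℓ : ℤ) : ℤ_[p])) + PowerSeries.X * U) ∧
          ∀ k : ℕ, ∃ (c : unrIntegers p) (U : UnrSeries p),
            A ℓ = PowerSeries.C c + (PowerSeries.X - PowerSeries.C (toUnr p (x k))) * U ∧
            ((c : ℂ_[p]) = algebraMap (PadicAlgCl p) ℂ_[p]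
              ((D k).ι ⟨(UpperHalfPlane.qExpansion 1 ⇑(D k).g).coeff ℓ, coeff_mem_coeffField (D k).g ℓ⟩))) →
      ∀ [TopologicalSpace (PowerSeries ℤ_[p])] (A₂ : Type) [AddCommGroup A₂]
        [Module (PowerSeries ℤ_[p]) A₂] [TopologicalSpace A₂] [DiscreteTopology A₂]
        (ρ₂ : ContinuousRep (Field.absoluteGaloisGroup K) (PowerSeries ℤ_[p]) A₂)
        [TopologicalSpace (PowerSeries (PowerSeries ℤ_[p]))]
        [ContinuousSMul (PowerSeries (PowerSeries ℤ_[p])) (BigRepModule (PowerSeries ℤ_[p]) p A₂)]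
        [Module (PowerSeries ℤ_[p]) (XBig κ ρ₂ 𝔭bar (∅ : Set (HeightOneSpectrum (𝓞 K))))]
        [IsScalarTower (PowerSeries ℤ_[p]) (PowerSeries (PowerSeries ℤ_[p]))
          (XBig κ ρ₂ 𝔭bar (∅ : Set (HeightOneSpectrum (𝓞 K))))],
        ((∀ a : A₂, ∃ n : ℕ, (PowerSeries.X : PowerSeries ℤ_[p]) ^ n • a = 0) ∧
          (∀ a : A₂, ∃ b : A₂, (PowerSeries.X : PowerSeries ℤ_[p]) • b = a) ∧
          (∀ (k : ℕ) (a : A₂), ∃ b : A₂, (PowerSeries.X - PowerSeries.C (x k)) • b = a) ∧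
          (∃ S₀ : Set (HeightOneSpectrum (𝓞 K)), S₀.Finite ∧ GaloisRep.IsUnramifiedOutside S₀ ρ₂) ∧
          (∃ θ₀ : Submodule.torsionBy (PowerSeries ℤ_[p]) A₂ (PowerSeries.X : PowerSeries ℤ_[p]) →+
              PrimaryTorsion (W.baseChange K).geomPoints p,
            (∀ (c : ℤ_[p]) (a : Submodule.torsionBy (PowerSeries ℤ_[p]) A₂ (PowerSeries.X : PowerSeries ℤ_[p])),
                θ₀ (PowerSeries.C c • a) = c • θ₀ a) ∧
            (∀ (σ : Field.absoluteGaloisGroup K)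
                (a : Submodule.torsionBy (PowerSeries ℤ_[p]) A₂ (PowerSeries.X : PowerSeries ℤ_[p])),
                θ₀ (BigGaloisRep.torsionRep ρ₂ (PowerSeries.X : PowerSeries ℤ_[p]) σ a) =
                  (W.baseChange K).primaryTorsionGaloisRep p σ (θ₀ a)) ∧
            Finite θ₀.ker ∧ Finite (PrimaryTorsion (W.baseChange K).geomPoints p ⧸ θ₀.range)) ∧
          (∀ k : ℕ, Function.Surjective (algebraMap ℤ_[p] (padicCoeffIntegers (D k).ι)) ∧
            ∃ θ : Submodule.torsionBy (PowerSeries ℤ_[p]) A₂ (PowerSeries.X - PowerSeries.C (x k)) →+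
                Cofree (D k).Δ.selfDualRep (padicCoeffField (D k).ι),
              (∀ (c : ℤ_[p])
                  (a : Submodule.torsionBy (PowerSeries ℤ_[p]) A₂ (PowerSeries.X - PowerSeries.C (x k))),
                  θ (PowerSeries.C c • a) = algebraMap ℤ_[p] (padicCoeffIntegers (D k).ι) c • θ a) ∧
              (∀ (σ : Field.absoluteGaloisGroup K)
                  (a : Submodule.torsionBy (PowerSeries ℤ_[p]) A₂ (PowerSeries.X - PowerSeries.C (x k))),
                  θ (BigGaloisRep.torsionRep ρ₂ (PowerSeries.X - PowerSeries.C (x k)) σ a) =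
                    (D k).Δ.selfDualCofreeRepOver K σ (θ a)) ∧
              Finite θ.ker ∧ Finite (Cofree (D k).Δ.selfDualRep (padicCoeffField (D k).ι) ⧸ θ.range))) →
        ∀ [Module (PowerSeries ℤ_[p]) (CharacterModule (TorsionControl.selmer (localMap K) (strictSet p 𝔭bar (∅ : Set (HeightOneSpectrum (𝓞 K))))
            (TorsionControl.torsionRep (AnticyclotomicBigGaloisRep κ ρ₂) (PowerSeries.C (PowerSeries.X : PowerSeries ℤ_[p])))))]
          [IsScalarTower (PowerSeries ℤ_[p]) (PowerSeries (PowerSeries ℤ_[p]))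
            (CharacterModule (TorsionControl.selmer (localMap K) (strictSet p 𝔭bar (∅ : Set (HeightOneSpectrum (𝓞 K))))
            (TorsionControl.torsionRep (AnticyclotomicBigGaloisRep κ ρ₂) (PowerSeries.C (PowerSeries.X : PowerSeries ℤ_[p])))))],
          Module.Finite (PowerSeries ℤ_[p]) (CharacterModule (TorsionControl.selmer (localMap K) (strictSet p 𝔭bar (∅ : Set (HeightOneSpectrum (𝓞 K))))
            (TorsionControl.torsionRep (AnticyclotomicBigGaloisRep κ ρ₂) (PowerSeries.C (PowerSeries.X : PowerSeries ℤ_[p]))))) := by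
  intro W _ _ p _ _N _ K _ _ _Dt _H _ιK _P _ _ _ _ _ _ _ _ _ _ κ _ _γ _ _𝔭 _ _ _ 𝔭bar _ _ _ _f _ _ι' _ _ΩK _Ωp _Q _ _ _
    _L _x _D _ _ A₂ _ _ _ _ ρ₂ _ _ _ _ hFD _ _
  obtain ⟨htor, -, -, hur, ⟨θ₀, hθC, -, hker, -⟩, -⟩ := hFD
  have hpK : (p : K) ≠ 0 := Nat.cast_ne_zero.mpr (Fact.out : p.Prime).ne_zero
  haveI := TelescopeK2TorsionSelmerCofinite.module_finite_characterModule_selmer_torsionRep_twoVar_of_isUnramifiedOutside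
    κ ρ₂ (TelescopeK2FibreCofinite.isCofinitelyGenerated_bigRepModule_twoVar_of_fd_primaryTorsion (W.baseChange K) hpK
      htor θ₀ hθC hker) hur 𝔭bar (PowerSeries.C (PowerSeries.X : PowerSeries ℤ_[p]))
  exact TelescopeK2TorsionSelmerCofinite.module_finite_powerSeries_of_twoVar (Y := CharacterModule
      (TorsionControl.selmer (localMap K) (strictSet p 𝔭bar (∅ : Set (HeightOneSpectrum (𝓞 K))))
        (TorsionControl.torsionRep (AnticyclotomicBigGaloisRep κ ρ₂) (PowerSeries.C (PowerSeries.X : PowerSeries ℤ_[p])))))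
    (TelescopeK2TorsionSelmerCofinite.smul_characterModule_selmer_torsionRep_eq_zero _ _ _ _)

set_option maxHeartbeats 1600000 in
/-- **W1 (fg): the big unramified Selmer dual `XBig κ ρ₂ 𝔭̄ ∅` is a finitely generated `ℤ_p⟦X⟧⟦T⟧`-module** — the text of the
UNREGISTERED sub-leaf `K2Weight2.stub_bigModuleFinite` token for token, proved by name from N1's fibre data ((tor), (unr), (fd₀)):
cofinite generation of `A₂ ⊗ B^*` (helper #9, p750844/p751255) and Greenberg 2006 Prop. 3.2 with inflation (p748332/p748872).
Closes nothing (W1 is not a registered stub). [cite: Greenberg2006, §3 A Prop. 3.2 (p. 358 L37)] [cite: GreenbergLNM1716, §4] -/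
theorem bigModuleFinite :
    ∀ (W : WeierstrassCurve ℚ) [W.IsElliptic] [W.IsGloballyMinimal] (p : ℕ) [Fact p.Prime],
    ∀ (N : ℕ) [NeZero N] (K : Type) [Field K] [NumberField K] (Dt : ModularParametrizationData W N)
      (H : HeegnerDatum N (NumberField.discr K)) (ιK : K →+* ℂ) (P : (W.baseChange K).toAffine.Point),
      CellC W p → W.conductorNorm ℤ = N →
      IsImaginaryQuadratic K → NumberField.discr K < -4 → SatisfiesHeegnerHypothesis N K →
      (W.quadraticTwist (NumberField.discr K : ℚ)).entireLFunction 1 ≠ 0 →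
      WeierstrassCurve.Affine.Point.map ιK.toRatAlgHom P = heegnerPointComplex Dt H →
      ¬ (p : ℤ) ∣ Dt.c → ¬ IsOfFinAddOrder P →
      Odd (NumberField.discr K) →
      ∀ (κ : ZpExtension K p), κ.IsAnticyclotomic →
        ∀ (γ : Field.absoluteGaloisGroup K) [Fact (κ.IsTopGenerator γ)]
          (𝔭 : HeightOneSpectrum (𝓞 K)), ((p : ℕ) : 𝓞 K) ∈ 𝔭.asIdeal →
          𝔭.asIdeal.ramificationIdx (𝓞 ℚ) = 1 → 𝔭.asIdeal.inertiaDeg (𝓞 ℚ) = 1 →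
          ∀ (𝔭bar : HeightOneSpectrum (𝓞 K)), ((p : ℕ) : 𝓞 K) ∈ 𝔭bar.asIdeal → 𝔭bar ≠ 𝔭 →
            ((Ideal.span {(p : ℤ)}).primesOver (𝓞 K)).ncard = 2 →
          ∀ (f : CuspForm (CongruenceSubgroup.Gamma0 N) 2), IsNewformOf W f →
            ∀ (ι' : PadicAlgCl p ≃+* ℂ),
              (∀ (w : InfinitePlace K) (k : 𝓞 K),
                k ∈ 𝔭.asIdeal ↔ ‖ι'.symm (w.embedding (k : K))‖ < 1) →
              ∀ (ΩK : ℂ) (Ωp : ℂ_[p]) (Q : PowerSeries 𝓞_ℂ_[p]), ΩK ≠ 0 → ‖Ωp‖ = 1 →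
                R1.IsBDPLFunctionInt p ι' 𝔭 κ γ f ΩK Ωp Q →
      ∀ (L : PowerSeries (PowerSeries (unrIntegers p))) (x : ℕ → ℤ_[p]) (D : ℕ → Skinner2016.HidaCongruentForm W p 1),
        (∀ k, ‖x k‖ < 1) ∧ Filter.Tendsto x Filter.atTop (nhds 0) ∧
        (∃ e : ℕ, PowerSeries.C ((p : 𝓞_ℂ_[p]) ^ e) * Q ∈
          Ideal.span {PowerSeries.map (R1.unrToCpInt p) (PowerSeries.map (PowerSeries.constantCoeff (R := unrIntegers p)) L)}) ∧
        (∀ k : ℕ, (∀ y : coeffField (D k).g, ι' ((D k).ι y) = (y : ℂ)) ∧ 2 * ((p : ℤ) - 1) ∣ (D k).k - 2 ∧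
          ∃ (ΩKg : ℂ) (Ωpg : ℂ_[p]) (Lg : UnrSeries p), ΩKg ≠ 0 ∧ ‖Ωpg‖ = 1 ∧
            IsBDPLFunctionWt ι' 𝔭 κ γ (D k).g ΩKg Ωpg Lg ∧
          ∃ Ψ : UnrSeries p,
            (∃ U : PowerSeries (PowerSeries (unrIntegers p)),
              PowerSeries.map (PowerSeries.C (R := unrIntegers p)) Ψ =
                L + PowerSeries.C (PowerSeries.X - PowerSeries.C (toUnr p (x k))) * U) ∧
            (∃ e : ℕ, PowerSeries.C ((p : 𝓞_ℂ_[p]) ^ e) * PowerSeries.map (R1.unrToCpInt p) Ψ ∈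
              Ideal.span {PowerSeries.map (R1.unrToCpInt p) Lg})) ∧
        (∃ A : ℕ → UnrSeries p, ∀ ℓ : ℕ, ℓ.Prime → ¬ ℓ ∣ N →
          (∃ U : UnrSeries p, A ℓ = PowerSeries.C (toUnr p ((W.frobeniusTrace ℓ : ℤ) : ℤ_[p])) + PowerSeries.X * U) ∧
          ∀ k : ℕ, ∃ (c : unrIntegers p) (U : UnrSeries p),
            A ℓ = PowerSeries.C c + (PowerSeries.X - PowerSeries.C (toUnr p (x k))) * U ∧
            ((c : ℂ_[p]) = algebraMap (PadicAlgCl p) ℂ_[p]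
              ((D k).ι ⟨(UpperHalfPlane.qExpansion 1 ⇑(D k).g).coeff ℓ, coeff_mem_coeffField (D k).g ℓ⟩))) →
      ∀ [TopologicalSpace (PowerSeries ℤ_[p])] (A₂ : Type) [AddCommGroup A₂]
        [Module (PowerSeries ℤ_[p]) A₂] [TopologicalSpace A₂] [DiscreteTopology A₂]
        (ρ₂ : ContinuousRep (Field.absoluteGaloisGroup K) (PowerSeries ℤ_[p]) A₂)
        [TopologicalSpace (PowerSeries (PowerSeries ℤ_[p]))]
        [ContinuousSMul (PowerSeries (PowerSeries ℤ_[p])) (BigRepModule (PowerSeries ℤ_[p]) p A₂)]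
        [Module (PowerSeries ℤ_[p]) (XBig κ ρ₂ 𝔭bar (∅ : Set (HeightOneSpectrum (𝓞 K))))]
        [IsScalarTower (PowerSeries ℤ_[p]) (PowerSeries (PowerSeries ℤ_[p]))
          (XBig κ ρ₂ 𝔭bar (∅ : Set (HeightOneSpectrum (𝓞 K))))],
        ((∀ a : A₂, ∃ n : ℕ, (PowerSeries.X : PowerSeries ℤ_[p]) ^ n • a = 0) ∧
          (∀ a : A₂, ∃ b : A₂, (PowerSeries.X : PowerSeries ℤ_[p]) • b = a) ∧
          (∀ (k : ℕ) (a : A₂), ∃ b : A₂, (PowerSeries.X - PowerSeries.C (x k)) • b = a) ∧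
          (∃ S₀ : Set (HeightOneSpectrum (𝓞 K)), S₀.Finite ∧ GaloisRep.IsUnramifiedOutside S₀ ρ₂) ∧
          (∃ θ₀ : Submodule.torsionBy (PowerSeries ℤ_[p]) A₂ (PowerSeries.X : PowerSeries ℤ_[p]) →+
              PrimaryTorsion (W.baseChange K).geomPoints p,
            (∀ (c : ℤ_[p]) (a : Submodule.torsionBy (PowerSeries ℤ_[p]) A₂ (PowerSeries.X : PowerSeries ℤ_[p])),
                θ₀ (PowerSeries.C c • a) = c • θ₀ a) ∧
            (∀ (σ : Field.absoluteGaloisGroup K)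
                (a : Submodule.torsionBy (PowerSeries ℤ_[p]) A₂ (PowerSeries.X : PowerSeries ℤ_[p])),
                θ₀ (BigGaloisRep.torsionRep ρ₂ (PowerSeries.X : PowerSeries ℤ_[p]) σ a) =
                  (W.baseChange K).primaryTorsionGaloisRep p σ (θ₀ a)) ∧
            Finite θ₀.ker ∧ Finite (PrimaryTorsion (W.baseChange K).geomPoints p ⧸ θ₀.range)) ∧
          (∀ k : ℕ, Function.Surjective (algebraMap ℤ_[p] (padicCoeffIntegers (D k).ι)) ∧
            ∃ θ : Submodule.torsionBy (PowerSeries ℤ_[p]) A₂ (PowerSeries.X - PowerSeries.C (x k)) →+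
                Cofree (D k).Δ.selfDualRep (padicCoeffField (D k).ι),
              (∀ (c : ℤ_[p])
                  (a : Submodule.torsionBy (PowerSeries ℤ_[p]) A₂ (PowerSeries.X - PowerSeries.C (x k))),
                  θ (PowerSeries.C c • a) = algebraMap ℤ_[p] (padicCoeffIntegers (D k).ι) c • θ a) ∧
              (∀ (σ : Field.absoluteGaloisGroup K)
                  (a : Submodule.torsionBy (PowerSeries ℤ_[p]) A₂ (PowerSeries.X - PowerSeries.C (x k))),
                  θ (BigGaloisRep.torsionRep ρ₂ (PowerSeries.X - PowerSeries.C (x k)) σ a) =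
                    (D k).Δ.selfDualCofreeRepOver K σ (θ a)) ∧
              Finite θ.ker ∧ Finite (Cofree (D k).Δ.selfDualRep (padicCoeffField (D k).ι) ⧸ θ.range))) →
        Module.Finite (PowerSeries (PowerSeries ℤ_[p])) (XBig κ ρ₂ 𝔭bar (∅ : Set (HeightOneSpectrum (𝓞 K)))) := by
  intro W _ _ p _ _N _ K _ _ _Dt _H _ιK _P _ _ _ _ _ _ _ _ _ _ κ _ _γ _ _𝔭 _ _ _ 𝔭bar _ _ _ _f _ _ι' _ _ΩK _Ωp _Q _ _ _
    _L _x _D _ _ A₂ _ _ _ _ ρ₂ _ _ _ _ hFD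
  obtain ⟨htor, -, -, hur, ⟨θ₀, hθC, -, hker, -⟩, -⟩ := hFD
  have hpK : (p : K) ≠ 0 := Nat.cast_ne_zero.mpr (Fact.out : p.Prime).ne_zero
  exact TelescopeK2BigRepUnramified.module_finite_XBig_twoVar_of_isUnramifiedOutside κ ρ₂
    (TelescopeK2FibreCofinite.isCofinitelyGenerated_bigRepModule_twoVar_of_fd_primaryTorsion (W.baseChange K) hpK
      htor θ₀ hθC hker) hur 𝔭bar

set_option maxHeartbeats 1600000 in
/-- **W3 `stub_weightTwoTransport` from the E-side input (I-E) ALONE**: the LEAD's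
`TelescopeK2WeightTwoTransportOfInputs.weightTwoTransport_of_inputs` (p751200) with its (W3-fg) input discharged by `weightTwoFg`;
hypothesis and conclusion are the LEAD's `hE` binder and W3's text, token for token. Closes nothing (W3 is an UNREGISTERED sub-leaf; (I-E)
remains). [cite: GreenbergLNM1716, §4] [cite: SkinnerUrban2014, Prop. 3.2.3] -/
theorem weightTwoTransport_of_E
    (hE :
    ∀ (W : WeierstrassCurve ℚ) [W.IsElliptic] [W.IsGloballyMinimal] (p : ℕ) [Fact p.Prime],
    ∀ (N : ℕ) [NeZero N] (K : Type) [Field K] [NumberField K] (Dt : ModularParametrizationData W N)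
      (H : HeegnerDatum N (NumberField.discr K)) (ιK : K →+* ℂ) (P : (W.baseChange K).toAffine.Point),
      CellC W p → W.conductorNorm ℤ = N →
      IsImaginaryQuadratic K → NumberField.discr K < -4 → SatisfiesHeegnerHypothesis N K →
      (W.quadraticTwist (NumberField.discr K : ℚ)).entireLFunction 1 ≠ 0 →
      WeierstrassCurve.Affine.Point.map ιK.toRatAlgHom P = heegnerPointComplex Dt H →
      ¬ (p : ℤ) ∣ Dt.c → ¬ IsOfFinAddOrder P →
      Odd (NumberField.discr K) →
      ∀ (κ : ZpExtension K p), κ.IsAnticyclotomic →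
        ∀ (γ : Field.absoluteGaloisGroup K) [Fact (κ.IsTopGenerator γ)]
          (𝔭 : HeightOneSpectrum (𝓞 K)), ((p : ℕ) : 𝓞 K) ∈ 𝔭.asIdeal →
          𝔭.asIdeal.ramificationIdx (𝓞 ℚ) = 1 → 𝔭.asIdeal.inertiaDeg (𝓞 ℚ) = 1 →
          ∀ (𝔭bar : HeightOneSpectrum (𝓞 K)), ((p : ℕ) : 𝓞 K) ∈ 𝔭bar.asIdeal → 𝔭bar ≠ 𝔭 →
            ((Ideal.span {(p : ℤ)}).primesOver (𝓞 K)).ncard = 2 →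
          ∀ [TopologicalSpace (PowerSeries ℤ_[p])]
            [ContinuousSMul (PowerSeries ℤ_[p])
              (BigRepModule ℤ_[p] p (PrimaryTorsion (W.baseChange K).geomPoints p))],
            Module.Finite (PowerSeries ℤ_[p])
                (XBig κ ((W.baseChange K).primaryTorsionGaloisRep p) 𝔭bar (∅ : Set (HeightOneSpectrum (𝓞 K)))) ∧
              Module.IsTorsion (PowerSeries ℤ_[p])
                (XBig κ ((W.baseChange K).primaryTorsionGaloisRep p) 𝔭bar (∅ : Set (HeightOneSpectrum (𝓞 K))))) :
    ∀ (W : WeierstrassCurve ℚ) [W.IsElliptic] [W.IsGloballyMinimal] (p : ℕ) [Fact p.Prime],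
    ∀ (N : ℕ) [NeZero N] (K : Type) [Field K] [NumberField K] (Dt : ModularParametrizationData W N)
      (H : HeegnerDatum N (NumberField.discr K)) (ιK : K →+* ℂ) (P : (W.baseChange K).toAffine.Point),
      CellC W p → W.conductorNorm ℤ = N →
      IsImaginaryQuadratic K → NumberField.discr K < -4 → SatisfiesHeegnerHypothesis N K →
      (W.quadraticTwist (NumberField.discr K : ℚ)).entireLFunction 1 ≠ 0 →
      WeierstrassCurve.Affine.Point.map ιK.toRatAlgHom P = heegnerPointComplex Dt H →
      ¬ (p : ℤ) ∣ Dt.c → ¬ IsOfFinAddOrder P →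
      Odd (NumberField.discr K) →
      ∀ (κ : ZpExtension K p), κ.IsAnticyclotomic →
        ∀ (γ : Field.absoluteGaloisGroup K) [Fact (κ.IsTopGenerator γ)]
          (𝔭 : HeightOneSpectrum (𝓞 K)), ((p : ℕ) : 𝓞 K) ∈ 𝔭.asIdeal →
          𝔭.asIdeal.ramificationIdx (𝓞 ℚ) = 1 → 𝔭.asIdeal.inertiaDeg (𝓞 ℚ) = 1 →
          ∀ (𝔭bar : HeightOneSpectrum (𝓞 K)), ((p : ℕ) : 𝓞 K) ∈ 𝔭bar.asIdeal → 𝔭bar ≠ 𝔭 →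
            ((Ideal.span {(p : ℤ)}).primesOver (𝓞 K)).ncard = 2 →
          ∀ (f : CuspForm (CongruenceSubgroup.Gamma0 N) 2), IsNewformOf W f →
            ∀ (ι' : PadicAlgCl p ≃+* ℂ),
              (∀ (w : InfinitePlace K) (k : 𝓞 K),
                k ∈ 𝔭.asIdeal ↔ ‖ι'.symm (w.embedding (k : K))‖ < 1) →
              ∀ (ΩK : ℂ) (Ωp : ℂ_[p]) (Q : PowerSeries 𝓞_ℂ_[p]), ΩK ≠ 0 → ‖Ωp‖ = 1 →
                R1.IsBDPLFunctionInt p ι' 𝔭 κ γ f ΩK Ωp Q →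
      ∀ (L : PowerSeries (PowerSeries (unrIntegers p))) (x : ℕ → ℤ_[p]) (D : ℕ → Skinner2016.HidaCongruentForm W p 1),
        (∀ k, ‖x k‖ < 1) ∧ Filter.Tendsto x Filter.atTop (nhds 0) ∧
        (∃ e : ℕ, PowerSeries.C ((p : 𝓞_ℂ_[p]) ^ e) * Q ∈
          Ideal.span {PowerSeries.map (R1.unrToCpInt p) (PowerSeries.map (PowerSeries.constantCoeff (R := unrIntegers p)) L)}) ∧
        (∀ k : ℕ, (∀ y : coeffField (D k).g, ι' ((D k).ι y) = (y : ℂ)) ∧ 2 * ((p : ℤ) - 1) ∣ (D k).k - 2 ∧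
          ∃ (ΩKg : ℂ) (Ωpg : ℂ_[p]) (Lg : UnrSeries p), ΩKg ≠ 0 ∧ ‖Ωpg‖ = 1 ∧
            IsBDPLFunctionWt ι' 𝔭 κ γ (D k).g ΩKg Ωpg Lg ∧
          ∃ Ψ : UnrSeries p,
            (∃ U : PowerSeries (PowerSeries (unrIntegers p)),
              PowerSeries.map (PowerSeries.C (R := unrIntegers p)) Ψ =
                L + PowerSeries.C (PowerSeries.X - PowerSeries.C (toUnr p (x k))) * U) ∧
            (∃ e : ℕ, PowerSeries.C ((p : 𝓞_ℂ_[p]) ^ e) * PowerSeries.map (R1.unrToCpInt p) Ψ ∈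
              Ideal.span {PowerSeries.map (R1.unrToCpInt p) Lg})) ∧
        (∃ A : ℕ → UnrSeries p, ∀ ℓ : ℕ, ℓ.Prime → ¬ ℓ ∣ N →
          (∃ U : UnrSeries p, A ℓ = PowerSeries.C (toUnr p ((W.frobeniusTrace ℓ : ℤ) : ℤ_[p])) + PowerSeries.X * U) ∧
          ∀ k : ℕ, ∃ (c : unrIntegers p) (U : UnrSeries p),
            A ℓ = PowerSeries.C c + (PowerSeries.X - PowerSeries.C (toUnr p (x k))) * U ∧
            ((c : ℂ_[p]) = algebraMap (PadicAlgCl p) ℂ_[p]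
              ((D k).ι ⟨(UpperHalfPlane.qExpansion 1 ⇑(D k).g).coeff ℓ, coeff_mem_coeffField (D k).g ℓ⟩))) →
      ∀ [TopologicalSpace (PowerSeries ℤ_[p])] (A₂ : Type) [AddCommGroup A₂]
        [Module (PowerSeries ℤ_[p]) A₂] [TopologicalSpace A₂] [DiscreteTopology A₂]
        (ρ₂ : ContinuousRep (Field.absoluteGaloisGroup K) (PowerSeries ℤ_[p]) A₂)
        [TopologicalSpace (PowerSeries (PowerSeries ℤ_[p]))]
        [ContinuousSMul (PowerSeries (PowerSeries ℤ_[p])) (BigRepModule (PowerSeries ℤ_[p]) p A₂)]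
        [Module (PowerSeries ℤ_[p]) (XBig κ ρ₂ 𝔭bar (∅ : Set (HeightOneSpectrum (𝓞 K))))]
        [IsScalarTower (PowerSeries ℤ_[p]) (PowerSeries (PowerSeries ℤ_[p]))
          (XBig κ ρ₂ 𝔭bar (∅ : Set (HeightOneSpectrum (𝓞 K))))],
        ((∀ a : A₂, ∃ n : ℕ, (PowerSeries.X : PowerSeries ℤ_[p]) ^ n • a = 0) ∧
          (∀ a : A₂, ∃ b : A₂, (PowerSeries.X : PowerSeries ℤ_[p]) • b = a) ∧
          (∀ (k : ℕ) (a : A₂), ∃ b : A₂, (PowerSeries.X - PowerSeries.C (x k)) • b = a) ∧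
          (∃ S₀ : Set (HeightOneSpectrum (𝓞 K)), S₀.Finite ∧ GaloisRep.IsUnramifiedOutside S₀ ρ₂) ∧
          (∃ θ₀ : Submodule.torsionBy (PowerSeries ℤ_[p]) A₂ (PowerSeries.X : PowerSeries ℤ_[p]) →+
              PrimaryTorsion (W.baseChange K).geomPoints p,
            (∀ (c : ℤ_[p]) (a : Submodule.torsionBy (PowerSeries ℤ_[p]) A₂ (PowerSeries.X : PowerSeries ℤ_[p])),
                θ₀ (PowerSeries.C c • a) = c • θ₀ a) ∧
            (∀ (σ : Field.absoluteGaloisGroup K)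
                (a : Submodule.torsionBy (PowerSeries ℤ_[p]) A₂ (PowerSeries.X : PowerSeries ℤ_[p])),
                θ₀ (BigGaloisRep.torsionRep ρ₂ (PowerSeries.X : PowerSeries ℤ_[p]) σ a) =
                  (W.baseChange K).primaryTorsionGaloisRep p σ (θ₀ a)) ∧
            Finite θ₀.ker ∧ Finite (PrimaryTorsion (W.baseChange K).geomPoints p ⧸ θ₀.range)) ∧
          (∀ k : ℕ, Function.Surjective (algebraMap ℤ_[p] (padicCoeffIntegers (D k).ι)) ∧
            ∃ θ : Submodule.torsionBy (PowerSeries ℤ_[p]) A₂ (PowerSeries.X - PowerSeries.C (x k)) →+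
                Cofree (D k).Δ.selfDualRep (padicCoeffField (D k).ι),
              (∀ (c : ℤ_[p])
                  (a : Submodule.torsionBy (PowerSeries ℤ_[p]) A₂ (PowerSeries.X - PowerSeries.C (x k))),
                  θ (PowerSeries.C c • a) = algebraMap ℤ_[p] (padicCoeffIntegers (D k).ι) c • θ a) ∧
              (∀ (σ : Field.absoluteGaloisGroup K)
                  (a : Submodule.torsionBy (PowerSeries ℤ_[p]) A₂ (PowerSeries.X - PowerSeries.C (x k))),
                  θ (BigGaloisRep.torsionRep ρ₂ (PowerSeries.X - PowerSeries.C (x k)) σ a) =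
                    (D k).Δ.selfDualCofreeRepOver K σ (θ a)) ∧
              Finite θ.ker ∧ Finite (Cofree (D k).Δ.selfDualRep (padicCoeffField (D k).ι) ⧸ θ.range))) →
        ∀ [Module (PowerSeries ℤ_[p]) (CharacterModule (TorsionControl.selmer (localMap K) (strictSet p 𝔭bar (∅ : Set (HeightOneSpectrum (𝓞 K))))
            (TorsionControl.torsionRep (AnticyclotomicBigGaloisRep κ ρ₂) (PowerSeries.C (PowerSeries.X : PowerSeries ℤ_[p])))))]
          [IsScalarTower (PowerSeries ℤ_[p]) (PowerSeries (PowerSeries ℤ_[p]))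
            (CharacterModule (TorsionControl.selmer (localMap K) (strictSet p 𝔭bar (∅ : Set (HeightOneSpectrum (𝓞 K))))
            (TorsionControl.torsionRep (AnticyclotomicBigGaloisRep κ ρ₂) (PowerSeries.C (PowerSeries.X : PowerSeries ℤ_[p])))))],
          Module.Finite (PowerSeries ℤ_[p]) (CharacterModule (TorsionControl.selmer (localMap K) (strictSet p 𝔭bar (∅ : Set (HeightOneSpectrum (𝓞 K))))
            (TorsionControl.torsionRep (AnticyclotomicBigGaloisRep κ ρ₂) (PowerSeries.C (PowerSeries.X : PowerSeries ℤ_[p]))))) ∧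
          Module.IsTorsion (PowerSeries ℤ_[p]) (CharacterModule (TorsionControl.selmer (localMap K) (strictSet p 𝔭bar (∅ : Set (HeightOneSpectrum (𝓞 K))))
            (TorsionControl.torsionRep (AnticyclotomicBigGaloisRep κ ρ₂) (PowerSeries.C (PowerSeries.X : PowerSeries ℤ_[p]))))) ∧
          (∃ e : ℕ, Ideal.span {PowerSeries.C ((p : ℤ_[p]) ^ e)} *
              Literature.NumberTheory.EllipticCurves.Module.charIdeal (PowerSeries ℤ_[p])
                (CharacterModule (TorsionControl.selmer (localMap K) (strictSet p 𝔭bar (∅ : Set (HeightOneSpectrum (𝓞 K))))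
            (TorsionControl.torsionRep (AnticyclotomicBigGaloisRep κ ρ₂) (PowerSeries.C (PowerSeries.X : PowerSeries ℤ_[p]))))) ≤
            XAc.charIdeal (W.baseChange K) p κ 𝔭bar ∅ γ) :=
  TelescopeK2WeightTwoTransportOfInputs.weightTwoTransport_of_inputs hE weightTwoFg

end Summit.BirchSwinnertonDyer.BirchSwinnertonDyer.Theorems.TelescopeK2WeightTwoFg
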